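import Literature.NumberTheory.EllipticCurves.EichlerBasisTheoremOfTraceIdentity
import Literature.NumberTheory.EllipticCurves.TakahashiDegreeFormulaCoprimeProofs
import HarnessLib

/-!
# `stub_takahashi` (crux stmt-ABC-11338 `DefiniteXi.DefiniteRTControlPrime`) — ideator k1, gen 21
# FAMILY 1 (recognise & import): the `H_R` leaf pushed down to Pizer's trace identity at COPRIME level

Companion of `STUB-IDEAS-stub_takahashi-1.md` (gen 21); elaboration sanity only, nothing here is a
stub proof.  The stub `theorem stub_takahashi : takahashi2001_thm_2_3_of_coprime` is the reviewed
NAMED FACT (Takahashi 2001 Thm 2.3 at `r ∥ N`).  The k1 thread's standing two-leaf import is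
`H_R ∧ H_D ⟹ stub` (k1-g15/g18; the two leaves are restated VERBATIM below so that this file is
self-contained — the g18 companion under `Cruxes/` is not a built module).  New, typed here:

* `PizerTraceIdentityCoprime` — Pizer 1980 Thm 2.25 (2.8) (`r = 0`, `k = 2`) at level `(M, q)`,
  `q` prime, `gcd(M, q) = 1`, `M` ARBITRARY (Hijikata–Saito 1973 Lemma 1 / Pizer 1976 Thm 4 give
  the traces at every level): a statement about TRACES ONLY, in the tree's vocabulary
  (`cuspidalHeckeTrace`, `Brandt.matrix`, `σ₁`).
* `brandtEigenLattice_rank_one_of_coprime_of_traceIdentity : PizerTraceIdentityCoprime → H_R` —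
  PROVED, one line over the tree's level-general engine
  `BrandtJL.finrank_eigenLattice_eq_one_of_traceIdentity` (Pizer Thm 2.28, proof p. 360).
* `takahashi2001_thm_2_3_of_coprime_holds_of : H_R → H_D → stub` (g18 assembly, re-proved over the
  tree's `takahashi2001_thm_2_3_of_coprime_of_brandtDictionary_one'`) and
  `stub_takahashi_of_traceIdentity_of_dictionary : PizerTraceIdentityCoprime → H_D → stub` — PROVED.

So at Frey levels `M = 2^e m` the multiplicity-one half of the stub is a trace identity (two
classical trace formulas at non-square-free level), and the ONLY geometric residual is `H_D`
(Néron model of `J₀(Mq)` at `q`, Grothendieck's pairing, Kohel's isometry; absent from tree and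
Mathlib).  [cite: Pizer1980, Thm. 2.25 (2.8), Thm. 2.28] [cite: Takahashi2001, §2 p. 78, Thm. 2.3]
-/

set_option linter.dupNamespace false

noncomputable section

namespace Summit.ABC.ABC.Cruxes.DefiniteRTControlPrime.StubIdeas1G21

open scoped BigOperators ArithmeticFunction.sigma
open ArithmeticFunction
open Literature.NumberTheory.EllipticCurves Literature.NumberTheory.EllipticCurves.ModularForms
open Literature.NumberTheory.Automorphic Literature.NumberTheory.Automorphic.Brandt
open Literature.NumberTheory.Automorphic.HeckeTraceFormulaGL2Level

/-! ## The two leaves of the standing import (k1-g15/g18 VERBATIM) -/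

/-- `H_R` — multiplicity one for the Brandt eigen-lattice at coprime level `(M, r)` (Takahashi 2001
p. 78 "`L_r(J)` is free of rank one"; Pizer 1980 Thm. 2.28). Leaf; PROVED in tree only at
square-free `M r` (`takahashi2001_brandtEigenLattice_rank_one_holds`). -/
def brandtEigenLattice_rank_one_of_coprime : Prop :=
  ∀ (W : WeierstrassCurve ℚ) [W.IsElliptic] (M r : ℕ) [NeZero (M * r)],
    r.Prime → M.Coprime r → W.conductorNorm ℤ = M * r →
    ∀ (_P : ModularParametrizationData W (M * r)) (S : Brandt.XiSetup M r)
      [Fintype (Brandt.ClassSet S.O)],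
      Module.finrank ℤ
        (Brandt.eigenLattice (M * r) (Brandt.matrix S.O) (fun n => W.LFunction n)) = 1

/-- `H_D` — the character-group dictionary at `r ∥ N` in the stub's idiom (`c_r := ord_r Δ_min`):
Conrad–Stein 2001 Thm 6.1 + §7.1 (`M` arbitrary) ∘ Kohel 2001 Thm 4.3 (`D = 1`); SGA 7 IX 11.5.
Leaf (XL: Néron models of `J₀(N)`, Grothendieck's pairing — not in tree / Mathlib). -/
def characterGroupDictionary_of_coprime : Prop :=
  ∀ (W : WeierstrassCurve ℚ) [W.IsElliptic] (M r : ℕ) [NeZero (M * r)],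
    r.Prime → M.Coprime r → W.conductorNorm ℤ = M * r →
    ∀ P : ModularParametrizationData W (M * r),
      (∀ (W' : WeierstrassCurve ℚ) [W'.IsElliptic], W'.conductorNorm ℤ = M * r →
          ∀ P' : ModularParametrizationData W' (M * r),
          P'.f = P.f → P.modularDegree ≤ P'.modularDegree) →
      ∀ (S : Brandt.XiSetup M r) [Fintype (Brandt.ClassSet S.O)],
        ∃ (X : Submodule ℤ (Brandt.ClassSet S.O → ℤ)) (pb : ℤ →ₗ[ℤ] X) (pf : X →ₗ[ℤ] ℤ),
          (∀ (a : ℤ) (y : X),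
              ∑ i, (Brandt.weight S.O i : ℤ) * (pb a : Brandt.ClassSet S.O → ℤ) i *
                  (y : Brandt.ClassSet S.O → ℤ) i =
                ((W.minimalDiscriminantNorm ℤ).factorization r : ℤ) * a * pf y) ∧
          (∀ a : ℤ, pf (pb a) = (P.modularDegree : ℤ) * a) ∧
          Function.Surjective pf ∧
          (∀ (m : ℤ) (v : Brandt.ClassSet S.O → ℤ), m ≠ 0 → m • v ∈ X → v ∈ X) ∧
          (pb 1 : Brandt.ClassSet S.O → ℤ) ∈
            Brandt.eigenLattice (M * r) (Brandt.matrix S.O) (fun n => W.LFunction n)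

/-- `A` — the stub from the two leaves (through the tree's PROVED reduction
`takahashi2001_thm_2_3_of_coprime_of_brandtDictionary_one'`). PROVED. -/
theorem takahashi2001_thm_2_3_of_coprime_holds_of (h₁ : brandtEigenLattice_rank_one_of_coprime)
    (h₂ : characterGroupDictionary_of_coprime) : takahashi2001_thm_2_3_of_coprime := by
  refine takahashi2001_thm_2_3_of_coprime_of_brandtDictionary_one' ?_
  intro W _ M r _ hr hcop hN P hmin hne
  obtain ⟨S₀⟩ := hne
  classical
  letI : Fintype (Brandt.ClassSet S₀.O) := Fintype.ofFinite _
  obtain ⟨X, pb, pf, hadj, hδ, hsurj, hXsat, hmem⟩ := h₂ W M r hr hcop hN P hmin S₀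
  exact ⟨S₀, inferInstance, X, pb, pf, hadj, hδ, hsurj, hXsat, h₁ W M r hr hcop hN P S₀, hmem⟩

/-! ## New (gen 21): `H_R` is a trace identity, not geometry -/

/-- **Pizer's trace identity (2.8) at coprime level** `(M, q)`, `q` prime, `gcd(M, q) = 1`, for every
Brandt setup `S` of type `(M, q)` and every `n ≥ 1` prime to `M q`:
`tr_{S₂(Γ₀(Mq))} T(n) = tr B(n) − σ₁(n) + 2 · tr_{S₂(Γ₀(M))} T(n)`.  Named here as the `GL₂`/quaternion
TRACE input of `H_R`; in print at every `M` (Pizer 1980 Thm 2.25 with Hijikata–Saito 1973); a tree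
theorem at square-free `M q` (`cuspidalHeckeTrace_eq_geometricSide` + Eichler's Brandt trace formula). -/
def PizerTraceIdentityCoprime : Prop :=
  ∀ (M q : ℕ) [NeZero M] [NeZero (M * q)], q.Prime → M.Coprime q →
    ∀ (S : XiSetup M q) [Fintype (ClassSet S.O)], ∀ n : ℕ, 0 < n → n.Coprime (M * q) →
      cuspidalHeckeTrace (M * q) 2 1 n =
        (((Brandt.matrix S.O n).trace : ℤ) : ℂ) - ((σ 1 n : ℕ) : ℂ) + 2 * cuspidalHeckeTrace M 2 1 n

/-- **`H_R` at coprime level from the trace identity** (the level-general engine of the tree,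
`BrandtJL.finrank_eigenLattice_eq_one_of_traceIdentity`, never used square-freeness). PROVED. -/
theorem brandtEigenLattice_rank_one_of_coprime_of_traceIdentity (h : PizerTraceIdentityCoprime) :
    brandtEigenLattice_rank_one_of_coprime := by
  intro W _ M r _ hr hcop _hN P S _
  haveI : NeZero M := ⟨fun h0 => NeZero.ne (M * r) (by rw [h0, zero_mul])⟩
  exact BrandtJL.finrank_eigenLattice_eq_one_of_traceIdentity S (h M r hr hcop S) W hr.one_lt P

/-- **The stub from the trace identity and the geometric dictionary `H_D`.** PROVED; neither
hypothesis is asserted. -/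
theorem stub_takahashi_of_traceIdentity_of_dictionary (h₁ : PizerTraceIdentityCoprime)
    (h₂ : characterGroupDictionary_of_coprime) : takahashi2001_thm_2_3_of_coprime :=
  takahashi2001_thm_2_3_of_coprime_holds_of (brandtEigenLattice_rank_one_of_coprime_of_traceIdentity h₁) h₂

/-- Door (Plan A, verbatim stub shape, conditional): inside the skeleton the literature match
yields exactly `exact h`. -/
theorem stub_takahashi_of_fact (h : takahashi2001_thm_2_3_of_coprime) :
    takahashi2001_thm_2_3_of_coprime := h

end Summit.ABC.ABC.Cruxes.DefiniteRTControlPrime.StubIdeas1G21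

end
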